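import Literature.Barriers.RiemannHypothesis.EpsteinZetaRealZerosPairGrouping
import HarnessLib

/-!
# Low's grouping with a ROUND partner class (`4/5 ≤ k₂ ≤ 1`): the mixed criterion

Barrier audit (D-0021) of `Literature.Barriers.RiemannHypothesis.EpsteinZetaRealZeros`, continued
(generation 9, 2026-08-27). Everything in this file is PROVED (theorems only).

`EpsteinZetaRealZerosPairGrouping.lean` groups the principal class of a discriminant `−d` with a partner
class of height `1 ≤ y₂ ≤ 6`, both handled by the constant-term decomposition
`Λ_z(σ) = 2y^σΛ(2σ) + 2y^{1−σ}Λ(2 − 2σ) + E_z(σ)` (whose remainder bound in the tree needs `y ≥ 1`).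
When the partner is a ROUND class — `4/5 ≤ y₂ ≤ 1`, e.g. `(11, 9, 11)` for `d = 403`, height
`√403/22 = 0.912…` — the decomposition is replaced, for that class only, by the quantitative form of
the tree's `re_thetaΛ_neg_of_im_le_one`: **`Re Λ_z(σ) ≤ 5/6 − 1/σ − 1/(1 − σ)`** on `(0, 1)`
(`re_Λ_le_of_im_le_one`: the majorant `Θ_z − 1 ≤ 7e^{−πyt}` gives `Re Λ₀,z ≤ 5/6`). The principal
class keeps its decomposition, and the sum is controlled by the elementary **mixed cell check**
`W·(H − 2) ≤ 2 − (1 − p²)B` (`mixed_cell`), where `H = (1 − p)[(X − 1)/q + (1 + q)M(X + 1)]` is the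
single-class quantity of `smallK_cell` (here `> 2`: the principal class alone fails), `W ≥ y₁^{(1−p)/2}`
and `B = β₁ + 5/12 (+ δ)`.

## Results

* `re_Λ_le_of_im_le_one` — `4/5 ≤ Im z ≤ 1`, `0 < σ < 1`: `Re Λ_z(σ) ≤ 5/6 − 1/σ − 1/(1−σ)`.
* `mixed_cell` — the cell lemma (integer-power certificates `Y^{kq} ≤ X^{nq}`, `Y^{ke} ≤ W^{ne}`).
* `re_Λ_add_re_Λ_lt_of_mixedKey` — the analytic core: principal `z₁` (`1 ≤ y₁`, Bessel allowance
  `β₁`, `M = 0.0236` from `re_completedRiemannZeta₀_lt_sharp`) plus round `z₂`, key inequality ⇒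
  `Re Λ_{z₁}(σ) + Re Λ_{z₂}(σ) < −2δ` on `(½, 1)`.

The transfer to `(0, 1)`, to arbitrary continuations and to `L(σ, χ_{−d})` is the generic
`re_add_re_neg_of_Ioo_half_one` / `pair_re_neg_of_Λ` / `LFunction_re_pos_of_pair` of the previous
file; the instance `d = 403` is `EpsteinZetaRealZerosPairGrouping403.lean`.

## References

* [Low1968] M. E. Low, Acta Arith. 14 (1968) 117–140, Theorem 5 (via MR 38#4425).
* [BatemanGrosswald1964] P. T. Bateman, E. Grosswald, Acta Arith. 9 (1964) 365–373, Theorem 1 (3)–(5),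
  Theorem 3 (10)–(11).
-/

noncomputable section

open Complex Filter Topology MeasureTheory Set HurwitzZeta
open scoped UpperHalfPlane

namespace Literature.Barriers.RiemannHypothesis

open Literature.NumberTheory.Automorphic
open Literature.NumberTheory.LFunctions.RealZeros

/-! ## The round class: `Re Λ_z(σ) ≤ 5/6 − 1/σ − 1/(1 − σ)` -/

/-- **Quantitative form of `re_thetaΛ_neg_of_im_le_one`.** For `4/5 ≤ y = Im z ≤ 1` and every
`0 < σ < 1`: `Re Λ_z(σ) ≤ 5/6 − 1/σ − 1/(1−σ)`. Same proof: the majorant `Θ_z(t) − 1 ≤ Ke^{−πyt}`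
(`t ≥ 1`), `K = 2(ϑ(1) + 1)/(1 − e^{−πy}) ≤ 7`, gives `Re Λ₀,z(σ) ≤ 2Ke^{−πy}/(πy) ≤ 5/6`, and
`Re Λ_z(σ) = Re Λ₀,z(σ) − 1/σ − 1/(1−σ)`. This is the round-lattice case of Bateman–Grosswald (11)
made uniform in `σ`. [cite: BatemanGrosswald1964, Theorem 3 (11)] -/
theorem re_Λ_le_of_im_le_one (z : ℍ) (hy45 : 4 / 5 ≤ z.im) (hy1 : z.im ≤ 1) {σ : ℝ}
    (hσ0 : 0 < σ) (hσ1 : σ < 1) :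
    ((thetaFEPair z).Λ σ).re ≤ 5 / 6 - 1 / σ - 1 / (1 - σ) := by
  set y := z.im with hydef
  have hy0 : 0 < y := by linarith
  have hπ := Real.pi_gt_three
  have hπy : 12 / 5 ≤ Real.pi * y := by nlinarith
  have hq : Real.exp (-Real.pi * y) ≤ 1 / 7 := by
    refine le_trans (Real.exp_le_exp.2 (by linarith)) exp_neg_two_lt.le
  have hq0 : 0 < Real.exp (-Real.pi * y) := Real.exp_pos _
  have hθ1 : evenKernel 0 1 ≤ 5 / 3 := by
    have h := evenKernel_zero_sub_one_le one_pos
    rw [mul_one] at h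
    have hq4 := exp_neg_pi_le
    have h0 : 0 < Real.exp (-Real.pi) := Real.exp_pos _
    have : 2 * Real.exp (-Real.pi) / (1 - Real.exp (-Real.pi)) ≤ 2 / 3 := by
      rw [div_le_div_iff₀ (by linarith) (by norm_num)]
      linarith
    linarith
  have hθ0 : 1 ≤ evenKernel 0 1 := one_le_evenKernel_zero one_pos
  set K : ℝ := 2 * (evenKernel 0 1 + 1) / (1 - Real.exp (-Real.pi * y)) with hK
  have hK0 : 0 ≤ K := by rw [hK]; exact div_nonneg (by linarith) (by linarith)
  have hK7 : K ≤ 7 := by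
    rw [hK, div_le_iff₀ (by linarith)]
    linarith
  set E : ℝ → ℂ := fun t =>
    (((Ioi (1 : ℝ)).indicator (fun u : ℝ => K * Real.exp (-(Real.pi * y) * u)) t : ℝ) : ℂ) with hE
  obtain ⟨hEconv, hEre⟩ := expPiece_mellin_of_le_one hK0 (by positivity : 0 < Real.pi * y) hE hσ1.le
  obtain ⟨hEconv', hEre'⟩ :=
    expPiece_mellin_of_le_one hK0 (by positivity : 0 < Real.pi * y) hE (s := 1 - σ) (by linarith)
  have hF0 : ∀ t ∈ Ioc (0 : ℝ) 1, E t = 0 := fun t ht => expPiece_of_le_one hE ht.2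
  have hpt : ∀ t : ℝ, 1 < t → thetaQ z t - 1 ≤ (E t).re := by
    intro t ht
    rw [expPiece_of_one_lt hE ht, Complex.ofReal_re]
    have h1 : thetaQ z t ≤ evenKernel 0 (y * t) * evenKernel 0 (t / y) :=
      thetaQ_le_evenKernel_mul z (by linarith : 0 < t)
    have h2 := thetaProd_sub_one_le hy0 hy1 ht.le
    linarith
  have hae₁ : ∀ᵐ t : ℝ, 1 < t → thetaQ z t - 1 ≤ (E t).re :=
    ae_of_all _ fun t ht => hpt t ht
  have hae₂ : ∀ᵐ t : ℝ, t ∈ Ioo (0 : ℝ) 1 →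
      thetaQ z (1 / t) - 1 ≤ (E (1 / t)).re :=
    ae_of_all _ fun t ht => hpt (1 / t) (one_lt_one_div ht.1 ht.2)
  have h1σ : (1 : ℂ) - (σ : ℂ) = ((1 - σ : ℝ) : ℂ) := by push_cast; ring
  have hEconv'' : MellinConvergent E (1 - (σ : ℂ)) := by rw [h1σ]; exact hEconv'
  have hmaj := re_Λ₀_le_of_majorant z σ hF0 hEconv hEconv'' hae₁ hae₂
  rw [h1σ] at hmaj
  rw [re_Λ_ofReal]
  have hexp : Real.exp (-(Real.pi * y)) ≤ 1 / 7 := by rw [← neg_mul]; exact hq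
  have hKq : K * Real.exp (-(Real.pi * y)) ≤ 7 * (1 / 7) :=
    mul_le_mul hK7 hexp (Real.exp_pos _).le (by norm_num)
  have hfrac : K * Real.exp (-(Real.pi * y)) / (Real.pi * y) ≤ 5 / 12 := by
    rw [div_le_iff₀ (by positivity)]
    linarith
  linarith

/-! ## The mixed cell lemma -/

/-- **The mixed cell lemma.** For the principal height `1 ≤ y ≤ Y`, a cell `p ≤ u ≤ q` in `(0, 1)`,
rational data `Y^q ≤ X` and `Y^{(1−p)/2} ≤ W` (given as integer-power certificates), `0 ≤ M`,
`0 ≤ B ≤ 2`, the single check `W·(H − 2) ≤ 2 − (1 − p²)B` with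
`H = (1 − p)[(X − 1)/q + (1 + q)M(X + 1)]` gives
`y^{(1+u)/2}P(u) + y^{(1−u)/2}N(u) + B − 1/(1+u) − 1/(1−u) ≤ 0`
(`P = M − 1/(1+u) + 1/u`, `N = M − 1/(1−u) − 1/u`): with `x = y^u ∈ [1, X]`, `w = y^{(1−u)/2} ∈ [1, W]`
the left side times `u(1+u)(1−u)` is `u[w(H_x − 2) + (1 − u²)B − 2]`, `H_x ≤ H` as in `smallK_cell`,
and `w(H_x − 2) ≤ max(W(H − 2), 0)`. The partner class enters through `B` (`5/12` from
`re_Λ_le_of_im_le_one` plus the principal's Bessel allowance). [cite: Low1968, Theorem 5 (via MR 38#4425)] -/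
theorem mixed_cell {y Y X W p q u M B : ℝ} {kq nq ke ne : ℕ}
    (hy1 : 1 ≤ y) (hY : y ≤ Y) (hnq : nq ≠ 0) (hq : q * nq = kq) (hX0 : 0 ≤ X)
    (hX : Y ^ kq ≤ X ^ nq) (hne : ne ≠ 0) (he : (1 - p) / 2 * ne = ke) (hW0 : 0 ≤ W)
    (hW : Y ^ ke ≤ W ^ ne)
    (hpu : p ≤ u) (hu0 : 0 < u) (huq : u ≤ q) (hu1 : u < 1) (hp0 : 0 ≤ p) (hM : 0 ≤ M)
    (hB0 : 0 ≤ B) (hB2 : B ≤ 2)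
    (hcell : W * ((1 - p) * ((X - 1) / q + (1 + q) * (M * (X + 1))) - 2) ≤ 2 - (1 - p ^ 2) * B) :
    y ^ ((1 + u) / 2) * (M - 1 / (1 + u) + 1 / u) + y ^ ((1 - u) / 2) * (M - 1 / (1 - u) - 1 / u) +
      B - 1 / (1 + u) - 1 / (1 - u) ≤ 0 := by
  have hy0 : 0 < y := by linarith
  have hq0 : 0 < q := lt_of_lt_of_le hu0 huq
  have hY0 : 0 ≤ Y := by linarith
  -- the certificates as real-power bounds
  replace hX : Y ^ q ≤ X := rpow_le_of_pow_le hY0 hX0 hnq hq hX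
  replace hW : Y ^ ((1 - p) / 2) ≤ W := rpow_le_of_pow_le hY0 hW0 hne he hW
  set x : ℝ := y ^ u with hx
  set w : ℝ := y ^ ((1 - u) / 2) with hw
  have hx1 : 1 ≤ x := Real.one_le_rpow hy1 hu0.le
  have hxX : x ≤ X := by
    calc x ≤ y ^ q := Real.rpow_le_rpow_of_exponent_le hy1 huq
      _ ≤ Y ^ q := Real.rpow_le_rpow hy0.le hY hq0.le
      _ ≤ X := hX
  have hw1 : 1 ≤ w := Real.one_le_rpow hy1 (by linarith)
  have hwW : w ≤ W := by
    calc w ≤ y ^ ((1 - p) / 2) := Real.rpow_le_rpow_of_exponent_le hy1 (by linarith)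
      _ ≤ Y ^ ((1 - p) / 2) := Real.rpow_le_rpow hy0.le hY (by linarith)
      _ ≤ W := hW
  have e1 : y ^ ((1 + u) / 2) = w * x := by
    rw [hw, hx, ← Real.rpow_add hy0]; congr 1; ring
  -- `H_x ≤ H`
  have hD : (x - 1) / u ≤ (X - 1) / q := by
    calc (x - 1) / u ≤ (y ^ q - 1) / q := rpow_sub_one_div_le hy1 hu0 huq
      _ ≤ (X - 1) / q := by
          apply div_le_div_of_nonneg_right _ hq0.le
          linarith [(Real.rpow_le_rpow hy0.le hY hq0.le).trans hX]
  have hD0 : 0 ≤ (x - 1) / u := div_nonneg (by linarith) hu0.le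
  set Hx : ℝ := (1 - u) * ((x - 1) / u) + (1 - u) * (1 + u) * (M * (x + 1)) with hHx
  set Hc : ℝ := (1 - p) * ((X - 1) / q + (1 + q) * (M * (X + 1))) with hHc
  have hHle : Hx ≤ Hc := by
    have hT0 : 0 ≤ M * (x + 1) := by positivity
    have hT : M * (x + 1) ≤ M * (X + 1) := by
      have := mul_le_mul_of_nonneg_left (add_le_add_right hxX 1) hM
      linarith
    calc Hx = (1 - u) * ((x - 1) / u) + (1 - u) * (1 + u) * (M * (x + 1)) := rfl
      _ ≤ (1 - p) * ((X - 1) / q) + (1 - p) * (1 + q) * (M * (X + 1)) := by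
          refine add_le_add (mul_le_mul (by linarith) hD hD0 (by linarith)) ?_
          exact mul_le_mul (mul_le_mul (by linarith) (by linarith) (by linarith) (by linarith))
            hT hT0 (mul_nonneg (by linarith) (by linarith))
      _ = Hc := by rw [hHc]; ring
  -- `w (H_x − 2) ≤ max(W (Hc − 2), 0)` and `(1 − u²)B ≤ (1 − p²)B`
  have hwH : w * (Hx - 2) + (1 - u ^ 2) * B ≤ 2 := by
    have hup : (1 - u ^ 2) * B ≤ (1 - p ^ 2) * B := by
      apply mul_le_mul_of_nonneg_right _ hB0
      nlinarith
    rcases le_or_gt Hc 2 with hc | hc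
    · have : w * (Hx - 2) ≤ 0 := mul_nonpos_of_nonneg_of_nonpos (by linarith) (by linarith)
      have : (1 - u ^ 2) * B ≤ 2 := by nlinarith
      linarith
    · have h1 : w * (Hx - 2) ≤ w * (Hc - 2) := mul_le_mul_of_nonneg_left (by linarith) (by linarith)
      have h2 : w * (Hc - 2) ≤ W * (Hc - 2) := mul_le_mul_of_nonneg_right hwW (by linarith)
      linarith
  -- clear denominators: `u(1+u)(1−u) · f = u · [w(H_x − 2) + (1 − u²)B − 2]`
  have hu : u ≠ 0 := hu0.ne'
  have h1u : 1 + u ≠ 0 := by linarith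
  have h1u' : 1 - u ≠ 0 := by linarith
  have hpos : 0 < u * (1 + u) * (1 - u) := mul_pos (mul_pos hu0 (by linarith)) (by linarith)
  rw [e1]
  have key : (w * x * (M - 1 / (1 + u) + 1 / u) + w * (M - 1 / (1 - u) - 1 / u) +
      B - 1 / (1 + u) - 1 / (1 - u)) * (u * (1 + u) * (1 - u)) =
      u * (w * (Hx - 2) + (1 - u ^ 2) * B - 2) := by
    rw [hHx]
    field_simp
    ring
  by_contra hneg
  have hlt : 0 < (w * x * (M - 1 / (1 + u) + 1 / u) + w * (M - 1 / (1 - u) - 1 / u) +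
      B - 1 / (1 + u) - 1 / (1 - u)) * (u * (1 + u) * (1 - u)) :=
    mul_pos (lt_of_not_ge hneg) hpos
  rw [key] at hlt
  have : u * (w * (Hx - 2) + (1 - u ^ 2) * B - 2) ≤ 0 :=
    mul_nonpos_of_nonneg_of_nonpos hu0.le (by linarith)
  linarith

/-! ## The analytic core of the mixed criterion -/

/-- One height by the constant-term decomposition with `M = 0.0236`:
`Re Λ_z(σ) < 2y^σP(u) + 2y^{1−σ}N(u) + 2β` for `1 ≤ y`, `½ < σ < 1`, `u = 2σ − 1`, given the Bessel
allowance `48√y e^{−1.4πy} ≤ 2β`. [cite: BatemanGrosswald1964, Theorem 1 (3)–(5)] -/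
theorem re_Λ_lt_of_decomposition (z : ℍ) (hz : 1 ≤ z.im) {σ : ℝ} (hσ : 1 / 2 < σ) (hσ1 : σ < 1)
    {β : ℝ} (hEz : 48 * Real.sqrt z.im * Real.exp (-(7 / 5) * Real.pi * z.im) ≤ 2 * β) :
    ((thetaFEPair z).Λ σ).re <
      2 * z.im ^ σ * (0.0236 - 1 / (1 + (2 * σ - 1)) + 1 / (2 * σ - 1)) +
        2 * z.im ^ (1 - σ) * (0.0236 - 1 / (1 - (2 * σ - 1)) - 1 / (2 * σ - 1)) + 2 * β := by
  set u : ℝ := 2 * σ - 1 with hu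
  have hu0 : 0 < u := by rw [hu]; linarith
  have hu1 : u < 1 := by rw [hu]; linarith
  have hσ0 : (0 : ℝ) < σ := by linarith
  have h0 : (σ : ℂ) ≠ 0 := by exact_mod_cast hσ0.ne'
  have h1 : (σ : ℂ) ≠ 1 := by exact_mod_cast hσ1.ne
  have hh : (σ : ℂ) ≠ 1 / 2 := by
    intro h
    have := congrArg Complex.re h
    simp at this
    linarith
  set y := z.im with hydef
  have hy0 : 0 < y := by linarith
  have hdec := Λ_eq_constantTerm_add_besselPart z hz h0 h1 hh
  have eA : (2 * ((y : ℝ) : ℂ) ^ (σ : ℂ) * completedRiemannZeta (2 * (σ : ℂ))).re =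
      2 * y ^ σ * (completedRiemannZeta ((1 + u : ℝ) : ℂ)).re := by
    rw [show (2 : ℂ) * (σ : ℂ) = ((1 + u : ℝ) : ℂ) by rw [hu]; push_cast; ring,
      ← Complex.ofReal_cpow hy0.le,
      show (2 : ℂ) * ((y ^ σ : ℝ) : ℂ) = ((2 * y ^ σ : ℝ) : ℂ) by push_cast; ring,
      Complex.re_ofReal_mul]
  have eB : (2 * ((y : ℝ) : ℂ) ^ (1 - (σ : ℂ)) * completedRiemannZeta (2 - 2 * (σ : ℂ))).re =
      2 * y ^ (1 - σ) * (completedRiemannZeta ((1 - u : ℝ) : ℂ)).re := by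
    rw [show (2 : ℂ) - 2 * (σ : ℂ) = ((1 - u : ℝ) : ℂ) by rw [hu]; push_cast; ring,
      show (1 : ℂ) - (σ : ℂ) = ((1 - σ : ℝ) : ℂ) by push_cast; ring, ← Complex.ofReal_cpow hy0.le,
      show (2 : ℂ) * ((y ^ (1 - σ) : ℝ) : ℂ) = ((2 * y ^ (1 - σ) : ℝ) : ℂ) by push_cast; ring,
      Complex.re_ofReal_mul]
  -- `Re Λ(1 ± u) < 0.0236 ∓ …` from `re_completedRiemannZeta₀_lt_sharp`
  have hP : (completedRiemannZeta ((1 + u : ℝ) : ℂ)).re < 0.0236 - 1 / (1 + u) + 1 / u := by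
    have h := re_completedRiemannZeta_lt_sharp_of_one_lt (u := 1 + u) (by linarith) (by linarith)
    rw [show (1 : ℝ) + u - 1 = u by ring] at h
    exact h
  have hN : (completedRiemannZeta ((1 - u : ℝ) : ℂ)).re < 0.0236 - 1 / (1 - u) - 1 / u := by
    rw [completedRiemannZeta_eq]
    have hE := re_completedRiemannZeta₀_lt_sharp (σ := 1 - u) (by linarith) (by linarith)
    have hσ' : (1 / ((1 - u : ℝ) : ℂ)).re = 1 / (1 - u) := by
      rw [← Complex.ofReal_one, ← Complex.ofReal_div, Complex.ofReal_re]
    have hσ'' : (1 / (1 - ((1 - u : ℝ) : ℂ))).re = 1 / u := by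
      rw [← Complex.ofReal_one, ← Complex.ofReal_sub, ← Complex.ofReal_div, Complex.ofReal_re]
      rw [show (1 : ℝ) - (1 - u) = u by ring]
    simp only [sub_re, hσ', hσ'']
    linarith
  have hyσ : 0 < y ^ σ := Real.rpow_pos_of_pos hy0 σ
  have hy1σ0 : 0 < y ^ (1 - σ) := Real.rpow_pos_of_pos hy0 _
  have hE : (epsteinBesselPart z σ).re ≤ 2 * β := by
    have hn := norm_epsteinBesselPart_le z hz (s := (σ : ℂ)) (by simp; linarith) (by simp; linarith)
    exact ((Complex.re_le_norm _).trans hn).trans hEz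
  have hA : 2 * y ^ σ * (completedRiemannZeta ((1 + u : ℝ) : ℂ)).re <
      2 * y ^ σ * (0.0236 - 1 / (1 + u) + 1 / u) := by nlinarith
  have hB : 2 * y ^ (1 - σ) * (completedRiemannZeta ((1 - u : ℝ) : ℂ)).re <
      2 * y ^ (1 - σ) * (0.0236 - 1 / (1 - u) - 1 / u) := by nlinarith
  rw [hdec, Complex.add_re, Complex.add_re, eA, eB]
  linarith

/-- **Analytic core of the mixed criterion.** Principal height `z₁` (`1 ≤ y₁`, Bessel allowance
`48√y₁ e^{−1.4πy₁} ≤ 2β₁`) and a ROUND partner `z₂` (`4/5 ≤ y₂ ≤ 1`); for `½ < σ < 1`,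
`u = 2σ − 1`, the key inequality
`y₁^σP(u) + y₁^{1−σ}N(u) + (β₁ + 5/12 + δ) − 1/(1+u) − 1/(1−u) ≤ 0` (`M = 0.0236`) yields
`Re Λ_{z₁}(σ) + Re Λ_{z₂}(σ) < −2δ`. [cite: Low1968, Theorem 5 (via MR 38#4425)] -/
theorem re_Λ_add_re_Λ_lt_of_mixedKey (z₁ z₂ : ℍ) (hy1 : 1 ≤ z₁.im) (hy2 : 4 / 5 ≤ z₂.im)
    (hy2' : z₂.im ≤ 1) {σ : ℝ} (hσ : 1 / 2 < σ) (hσ1 : σ < 1) {β₁ δ : ℝ}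
    (hE1 : 48 * Real.sqrt z₁.im * Real.exp (-(7 / 5) * Real.pi * z₁.im) ≤ 2 * β₁)
    (hkey : z₁.im ^ σ * (0.0236 - 1 / (1 + (2 * σ - 1)) + 1 / (2 * σ - 1)) +
      z₁.im ^ (1 - σ) * (0.0236 - 1 / (1 - (2 * σ - 1)) - 1 / (2 * σ - 1)) +
      (β₁ + 5 / 12 + δ) - 1 / (1 + (2 * σ - 1)) - 1 / (1 - (2 * σ - 1)) ≤ 0) :
    ((thetaFEPair z₁).Λ σ).re + ((thetaFEPair z₂).Λ σ).re < -(2 * δ) := by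
  have hσ0 : 0 < σ := by linarith
  have h1 := re_Λ_lt_of_decomposition z₁ hy1 hσ hσ1 hE1
  have h2 := re_Λ_le_of_im_le_one z₂ hy2 hy2' hσ0 hσ1
  have e1 : 1 / σ = 2 * (1 / (1 + (2 * σ - 1))) := by
    field_simp; ring
  have e2 : 1 / (1 - σ) = 2 * (1 / (1 - (2 * σ - 1))) := by
    have : (1 - σ) ≠ 0 := by linarith
    rw [show (1 : ℝ) - (2 * σ - 1) = 2 * (1 - σ) by ring]
    field_simp
  rw [e1, e2] at h2
  linarith

end Literature.Barriers.RiemannHypothesis
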